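/-
COR-CM (cell pub-hodgecm2, stage 2 of the Hodge ladder) — junction B01 `PerLFace_of_PerL`, leg B01-O: the JOINT THETA-PINNED END
DISPLAY (O-J) on the model universe.  AUTHORED AND FILED by the b01-x1 lineage (prover-pub-hodgecm2-b01-x1-g2-0, extra prover under
the single owner of B01 `pub-hodgecm2-own-b01`; path `CorCM/B01/FaceWedgeMeetJoint.lean` named for this seat by the lead's NAMING
RULING HOME/INBOX l.4194 (3) and own-b01's owner line l.4212 (c)); the two `Model.hc_cm_of_jointThetaPin[_rec]` statements are
own-b01 gen 2's probe `HOME/b01/JOINT-PIN-Sketch.lean` md5 214935dcfd1b, carried verbatim (credit: prover-pub-hodgecm2-own-b01-g2-0).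
Theorems only: no definition, no named fact, nothing cited as a record, nothing asserted, no `sorry`; `Transposition/*`, the E term
and `Interfaces.lean` (C1) untouched — `Transposition.Model.wedge_of_translateClosed_heckeFamily` (Item6HeckeFamily.lean, p277416),
`Transposition.IsolationSpans.ofSetting` / `faceThetaDatum_ofSetting` (Item5IsolationSpansHolds.lean, p280226) and
`Model.hc_cm_closed_of_exists_faceThetaDatum_free` / `hc_cm_of_exists_facePeriod_free` (AssemblyFree.lean, p277409) are imported BY NAME.
FRAMING (COORDINATOR RULINGS 2026-08-21T11:55:35Z, 15:33:56Z, 16:13:55Z): `HC_CM` is NOT proved; every per-face binder below is OPEN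
at a general face; no declaration below inhabits any displayed hypothesis.
-/
import Summits.HodgeConjecture.CorCM.B01.Transposition.AssemblyFree
import Summits.HodgeConjecture.CorCM.B01.Transposition.Item6HeckeFamily
import Summits.HodgeConjecture.CorCM.B01.Transposition.Item5IsolationSpansHolds
import HarnessLib

/-!
# B01-O, joint theta-pinned form (O-J): `HC_CM` from ONE PerL-shaped theta realisation per face, and its strength

(O-J) (own-b01, HOME/INBOX l.4212; lead l.4216; tr-prover-5 l.4241): B01-O (`Universe.FaceWedgeOverlap`, `B01/FaceInputsSplit.lean`
:101, ∀Γ∀ω over ALL isotypic classes) cannot be pinned independently of B01-S.  The coupling clause (α) the engine consumes is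
available in the tree PER ISOLATION SETTING (`Transposition.IsolationSpans.ofSetting`, `Item5IsolationSpansHolds.lean`:184 — PerL
Thm 3.7 PROVED for the datum of every setting), i.e. for the theta sets OF ONE seesaw configuration; asked at the SATURATED sets
`Θ := U_ψ` (the binder `hD` of `Model.hc_cm_of_supply_of_dictionary_of_eq`, `Transposition/Item6HoldsRec.lean`:211–224) it would carry
theta-exhaustion of `U_ψ` on top of PerL (the file `CorCM/B01/FaceWedgeOverlapOfExhaustion.lean` of b01-x2 is the kernel statement of
that gap).  The PerL-verbatim end display is therefore the JOINT one: supply INSIDE the theta sets of the configuration, the wedge by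
B01-H WITHIN the honest Hecke family, the coupling by the configuration's isolation setting.  This file states it BY NAME over landed
declarations and measures it against the socket `Universe.FaceThetaDataExists` (`Transposition/Assembly.lean`:52).

PER-FACE BINDER LIST of the display (one existential `h` per Galois CM field `F`, `6 ≤ [F:ℚ]`, and face `f`; quantified
`∃ ι₁ ∃ V ∃ σ` — no admissibility, no pin `σ = ι₁`, as in `Model.hc_cm_of_items_free`, `AssemblyFree.lean`):
  DATA   `S : Transposition.FaceThetaSupply U ι₁ V F f.psi σ` (theta sets `Θ_i ⊆ U_{ψ_i}` = `Theta_sub`, [Liu 2021 4.18]/[Y1neg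
         8.1(a)]-type placement; `supply` = two non-zero theta classes of slots 0, 1 at one level, PerL Lemma 4.2(a) — INSIDE `Θ`),
         item (iii)'s `(HG, emb, cover)` (`L²([G_U])`, Matsushima embeddings, level coverings), and an isolation setting
         `Siso : Perl34.IsolationSetting H HG CG G SK SigIdx SigIdxG` over the SAME `HG` (the seesaw plane of item (iv) with the two
         torus sides; its fields `H_chars`/`H_occ` = PerL Lemma 4.2(b)/4.1(c));
  PROPS  `S.TranslateClosed (Transposition.Model.heckeFamily …)` (PerL §3.1, tex ll.652–656: Hecke pull-backs of theta one-forms are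
         theta one-forms), `IsolationSpans.Gen12 U emb S.Theta (Datum.ofSetting Siso)` (Lemma 3.4 + 3.5, seesaw direction, FOR `S.Theta`),
         the generator form of `Real34` (Lemma 3.5, generation direction: each `ϑ_{T′,χ}(Φ)` in the closed span of the theta
         (34)-wedge-functions of `S.Theta`), `emb_cover` (change of level), `inner_emb` (Borel–Wallach: Petersson = cup on `F²H²`).
  NOT binders (tree theorems on the model): B01-H within the family (`Transposition.Model.heckeWedge10Within_holds`), Thm 3.7 for
  `Siso` (`IsolationSpans.spansCoincide_ofSetting`), Hodge–Riemann (2,0) (`Model.universeOf_hodgeRiemann_pms`), the four facts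
  `universeOf_fact_pull_comp/_pull_hodge/_cup2_hodge/_pull_cup`, Hom-fullness `deligneMilne1982_Thm_6_20_full_holds`.

Contents (namespace `Summit.HodgeConjecture.CorCM`):
* `Transposition.nonempty_faceThetaDatum_of_jointThetaPin` — UNIVERSE-GENERIC STRENGTH: at one context `(ι₁, V; K, Ψ, σ)`, the joint
  datum gives the socket datum `U.FaceThetaDatum ι₁ V K Ψ σ` (`B01/ThetaRealisationSocket.lean`:66), under `Fact_pull_hodge`,
  `Fact_cup2_hodge`, Hodge–Riemann (2,0) on the tower and B01-H within the Hecke family `Hk` used for translate-closure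
  (`wedge_of_translateClosed` ⟶ `lineField_of_wedge` ⟶ `IsolationSpans.faceThetaDatum_ofSetting`).
* `Transposition.exists_faceThetaDatum_free_of_jointThetaPin` — per field-and-face: the joint hypothesis implies the FREE socket form
  `∃ ι₁ V σ, Nonempty (U.FaceThetaDatum ι₁ V F f.psi σ)`; `Transposition.faceThetaDataExists_of_jointThetaPin_pinned` — its
  admissible, pinned (`σ = ι₁`) variant implies `U.FaceThetaDataExists` itself.
* `Model.exists_faceThetaDatum_free_of_jointThetaPin` — the same on `picardCMUniverse hHD hI h₁ h₃` with the facts, Hodge–Riemann and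
  B01-H-within-the-honest-family DISCHARGED by the tree theorems.
* `Model.hc_cm_of_jointThetaPin`, `Model.hc_cm_of_jointThetaPin_rec` — THE END DISPLAY (own-b01's probe 214935dcfd1b, signatures
  verbatim): `HC_CM` from the joint hypothesis (+ the four model data and Hom-fullness, resp. on the universe OF RECORD from the joint
  hypothesis ALONE).  Proof = `hc_cm_of_exists_facePeriod_free` ∘ engine ∘ the strength theorem, so the display FACTORS through the
  one-binder socket theorem `Model.hc_cm_closed_of_exists_faceThetaDatum_free` (`AssemblyFree.lean`).
* `Model.hc_cm_of_jointThetaPin_of_eq` — legible form over `hU : U = U_rec` (instantiate with `rfl`) and an ARBITRARY Hecke family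
  `Hk` with B01-H within it as the dischargeable binder `hW` (discharged for the honest family by `heckeWedge10Within_holds`).

STRENGTH vs `FaceThetaDataExists` (numbers, not adjectives): J(face) ⟹ socket(face) is a THEOREM here (free and pinned forms); the
converse is NOT claimed and is not formal: J carries two DATA the socket does not — an isolation-setting INSTANCE over the dictionary's
`HG` realising the coupling ((v-S); the socket's `coupling` is the collapsed composite `Gen12 ∘ Thm 3.7 ∘ Real34`, cf.
`IsolationSpans.refinement_of_isolationSpans`, which refines into an `IsolationSpans.Datum`, not into a `Perl34.IsolationSetting`) and
TRANSLATE-CLOSURE of the theta sets along the honest Hecke family (the socket keeps only the resulting `lineField`).  Modulo these two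
data the Props of J compose EXACTLY to the socket's two analytic fields (`coupling` by `ofSetting`, `lineField` by
`wedge_of_translateClosed` + `lineField_of_wedge`), and both displays close `HC_CM` through the same one-binder theorem.  So J is the
finer (harder to inhabit, PerL/stage-1-verbatim in shape) hypothesis; `FaceThetaDataExists` the coarser.  Neither is inhabited.
T5 (standing tribunal item, COORDINATOR RULING 15:33:56Z (3)): the per-face binder SET of `h` was submitted to pub-hodgecm2-t5-consist-1
on the exact bytes before filing (HOME/INBOX; verdict line in HOME/T5-LEDGER.md, quoted in the filing note).  In-kernel relative
certificate: `False` from `h` on the universe of record is `¬ J(U_rec)`, which by `Model.exists_faceThetaDatum_free_of_jointThetaPin`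
says nothing weaker than «some face of some Galois CM field of degree ≥ 6 admits no PerL-shaped theta realisation» — as open as B01.
-/

noncomputable section

open scoped TensorProduct InnerProductSpace

namespace Summit.HodgeConjecture.CorCM

open Literature.AlgebraicGeometry.Motives (CMType HodgeStructure)
open Literature.AlgebraicGeometry.Motives.HodgeStructure (conj)
open Literature.AlgebraicGeometry.HodgeTheory
open Literature.NumberTheory.Automorphic
open Literature.NumberTheory.Automorphic.PicardCM
open Prior.Perl34File (Perl34.IsolationSetting)
open Prior.Perl34File.Perl34

/-! ## §1  Universe-generic strength: the joint theta-pinned datum at one context gives the socket datum -/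

namespace Transposition

/-- **STRENGTH, one context.**  On a universe with `Fact_pull_hodge`, `Fact_cup2_hodge`, Hodge–Riemann (2,0) on the tower of
`(L, ι₁, V)` and B01-H within a Hecke family `Hk` (`HeckeWedge10Within U Hk`, `Item6SupplyAssembly.lean`:175): a theta supply datum
`S` whose theta sets are translate-closed along `Hk`, item (iii)'s `(HG, emb, cover)` with `emb_cover` and `inner_emb`, an isolation
setting `Siso` over the same `HG`, and the two Lemma-3.5 memberships for `S.Theta` (`Gen12` into `Siso.t12.S12`; generator-form
`Real34`) give the socket datum `U.FaceThetaDatum ι₁ V K Ψ σ` (`B01/ThetaRealisationSocket.lean`:66).  Composition BY NAME: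
Prop 4.3 `S.wedge_of_translateClosed` (supply + B01-H within `Hk` + translate-closure), `S.lineField_of_wedge` (HR (2,0) +
`inner_emb`), `IsolationSpans.faceThetaDatum_ofSetting` (Thm 3.7 for `Siso` is the proved `spansCoincide_ofSetting`). [folklore] -/
theorem nonempty_faceThetaDatum_of_jointThetaPin {U : Universe} (hH : U.Fact_pull_hodge) (hcup2 : U.Fact_cup2_hodge)
    {Hk : HeckeFamily U} (hW : HeckeWedge10Within U Hk)
    {L : CMField} {ι₁ : L →+* ℂ} {V : HermSpace3 L ι₁} {K : CMField} {Ψ : Fin 4 → CMType K} {σ : K →+* ℂ}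
    (hHR : ∀ (Γ : Level V) (η : U.CohC (U.pms L ι₁ V Γ) 2), η ∈ (U.hodge (U.pms L ι₁ V Γ) 2).F 2 → η ≠ 0 →
      U.trC (U.pms L ι₁ V Γ) 4 (U.cup2C (U.pms L ι₁ V Γ) 2 η (conj η)) ≠ 0)
    (S : FaceThetaSupply U ι₁ V K Ψ σ)
    {HG : Type} [NormedAddCommGroup HG] [InnerProductSpace ℂ HG] [CompleteSpace HG]
    (emb : ∀ Γ : Level V, U.CohC (U.pms L ι₁ V Γ) 2 →ₗ[ℂ] HG)
    (cover : ∀ (Γ Γ' : Level V), Γ' ≤ Γ → U.Mor (U.pms L ι₁ V Γ') (U.pms L ι₁ V Γ))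
    {H CG G SK SigIdx SigIdxG : Type}
    [NormedAddCommGroup H] [InnerProductSpace ℂ H] [CompleteSpace H]
    [NormedAddCommGroup CG] [NormedSpace ℂ CG] [Group G] [TopologicalSpace G] [TopologicalSpace SK]
    (Siso : Perl34.IsolationSetting H HG CG G SK SigIdx SigIdxG)
    (hT : S.TranslateClosed Hk)
    (hg : IsolationSpans.Gen12 U emb S.Theta (IsolationSpans.Datum.ofSetting Siso))
    (hr : ∀ χ : Siso.t34.X, Siso.t34.allowed χ → ∀ Φ : SK,
      Siso.t34.ϑ χ Φ ∈ (Submodule.span ℂ (thetaWedgeFns U emb S.Theta 2 3)).topologicalClosure)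
    (emb_cover : ∀ (Γ Γ' : Level V) (hle : Γ' ≤ Γ) (x : U.CohC (U.pms L ι₁ V Γ) 2),
      emb Γ' (U.pullC (cover Γ Γ' hle) 2 x) = emb Γ x)
    (inner_emb : ∀ Γ : Level V, ∃ c : ℂ, c ≠ 0 ∧ ∀ x y : U.CohC (U.pms L ι₁ V Γ) 2,
      x ∈ (U.hodge (U.pms L ι₁ V Γ) 2).F 2 → y ∈ (U.hodge (U.pms L ι₁ V Γ) 2).F 2 →
        ⟪emb Γ y, emb Γ x⟫_ℂ = c * U.trC (U.pms L ι₁ V Γ) 4 (U.cup2C (U.pms L ι₁ V Γ) 2 x (conj y))) :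
    Nonempty (U.FaceThetaDatum ι₁ V K Ψ σ) :=
  ⟨IsolationSpans.faceThetaDatum_ofSetting Siso emb S.Theta S.Theta_sub
    (S.lineField_of_wedge hH hcup2 emb inner_emb hHR (S.wedge_of_translateClosed hH hW hT)) hg hr cover emb_cover inner_emb⟩

/-- **STRENGTH, per field-and-face (free forms).**  Under the same universe facts (Hodge–Riemann (2,0) now on every tower): if every
face of every Galois CM field of degree `≥ 6` carries, at SOME `(ι₁, V, σ)`, a joint theta-pinned datum, then it carries face theta
data there — the FREE socket form, the hypothesis of `Model.hc_cm_closed_of_exists_faceThetaDatum_free` (`AssemblyFree.lean`).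
The joint display is thus AT LEAST AS STRONG a hypothesis as the socket; the converse is not claimed (the isolation-setting instance
and translate-closure are not recoverable from a socket datum). [folklore] -/
theorem exists_faceThetaDatum_free_of_jointThetaPin {U : Universe} (hH : U.Fact_pull_hodge) (hcup2 : U.Fact_cup2_hodge)
    {Hk : HeckeFamily U} (hW : HeckeWedge10Within U Hk)
    (hHR : ∀ {L : CMField} {ι₁ : L →+* ℂ} {V : HermSpace3 L ι₁} (Γ : Level V) (η : U.CohC (U.pms L ι₁ V Γ) 2),
      η ∈ (U.hodge (U.pms L ι₁ V Γ) 2).F 2 → η ≠ 0 → U.trC (U.pms L ι₁ V Γ) 4 (U.cup2C (U.pms L ι₁ V Γ) 2 η (conj η)) ≠ 0)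
    (h : ∀ (F : CMField), IsGalois ℚ F → 6 ≤ Module.finrank ℚ F → ∀ f : Face F,
      ∃ (ι₁ : F →+* ℂ) (V : HermSpace3 F ι₁) (σ : F →+* ℂ) (S : FaceThetaSupply U ι₁ V F f.psi σ)
        (HG : Type) (_ : NormedAddCommGroup HG) (_ : InnerProductSpace ℂ HG) (_ : CompleteSpace HG)
        (emb : ∀ Γ : Level V, U.CohC (U.pms F ι₁ V Γ) 2 →ₗ[ℂ] HG)
        (cover : ∀ (Γ Γ' : Level V), Γ' ≤ Γ → U.Mor (U.pms F ι₁ V Γ') (U.pms F ι₁ V Γ))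
        (H CG G SK SigIdx SigIdxG : Type)
        (_ : NormedAddCommGroup H) (_ : InnerProductSpace ℂ H) (_ : CompleteSpace H)
        (_ : NormedAddCommGroup CG) (_ : NormedSpace ℂ CG) (_ : Group G) (_ : TopologicalSpace G) (_ : TopologicalSpace SK)
        (Siso : Perl34.IsolationSetting H HG CG G SK SigIdx SigIdxG),
        S.TranslateClosed Hk ∧
        IsolationSpans.Gen12 U emb S.Theta (IsolationSpans.Datum.ofSetting Siso) ∧
        (∀ χ : Siso.t34.X, Siso.t34.allowed χ → ∀ Φ : SK,
          Siso.t34.ϑ χ Φ ∈ (Submodule.span ℂ (thetaWedgeFns U emb S.Theta 2 3)).topologicalClosure) ∧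
        (∀ (Γ Γ' : Level V) (hle : Γ' ≤ Γ) (x : U.CohC (U.pms F ι₁ V Γ) 2),
          emb Γ' (U.pullC (cover Γ Γ' hle) 2 x) = emb Γ x) ∧
        (∀ Γ : Level V, ∃ c : ℂ, c ≠ 0 ∧ ∀ x y : U.CohC (U.pms F ι₁ V Γ) 2,
          x ∈ (U.hodge (U.pms F ι₁ V Γ) 2).F 2 → y ∈ (U.hodge (U.pms F ι₁ V Γ) 2).F 2 →
            ⟪emb Γ y, emb Γ x⟫_ℂ = c * U.trC (U.pms F ι₁ V Γ) 4 (U.cup2C (U.pms F ι₁ V Γ) 2 x (conj y)))) :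
    ∀ (F : CMField), IsGalois ℚ F → 6 ≤ Module.finrank ℚ F → ∀ f : Face F,
      ∃ (ι₁ : F →+* ℂ) (V : HermSpace3 F ι₁) (σ : F →+* ℂ), Nonempty (U.FaceThetaDatum ι₁ V F f.psi σ) := by
  intro F hG h6 f
  obtain ⟨ι₁, V, σ, S, HG, _, _, _, emb, cover, H, CG, G, SK, SigIdx, SigIdxG, _, _, _, _, _, _, _, _, Siso,
    hT, hg, hr, hcov, hinner⟩ := h F hG h6 f
  exact ⟨ι₁, V, σ, nonempty_faceThetaDatum_of_jointThetaPin hH hcup2 hW (fun Γ η hη h0 => hHR Γ η hη h0) S emb cover Siso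
    hT hg hr hcov hinner⟩

/-- **STRENGTH vs `FaceThetaDataExists` itself (admissible, pinned form).**  If the joint theta-pinned datum is delivered at an
ADMISSIBLE surface embedding `ι₁` with eigen-embedding `σ = ι₁` (the quantifier shape of `Universe.FaceThetaDataExists`,
`Transposition/Assembly.lean`:52), then `U.FaceThetaDataExists` holds — the day-1 socket statement, by name. [folklore] -/
theorem faceThetaDataExists_of_jointThetaPin_pinned {U : Universe} (hH : U.Fact_pull_hodge) (hcup2 : U.Fact_cup2_hodge)
    {Hk : HeckeFamily U} (hW : HeckeWedge10Within U Hk)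
    (hHR : ∀ {L : CMField} {ι₁ : L →+* ℂ} {V : HermSpace3 L ι₁} (Γ : Level V) (η : U.CohC (U.pms L ι₁ V Γ) 2),
      η ∈ (U.hodge (U.pms L ι₁ V Γ) 2).F 2 → η ≠ 0 → U.trC (U.pms L ι₁ V Γ) 4 (U.cup2C (U.pms L ι₁ V Γ) 2 η (conj η)) ≠ 0)
    (h : ∀ (F : CMField), IsGalois ℚ F → 6 ≤ Module.finrank ℚ F → ∀ f : Face F,
      ∃ ι₁ : F →+* ℂ, f.Admissible ι₁ ∧ ∃ (V : HermSpace3 F ι₁) (S : FaceThetaSupply U ι₁ V F f.psi ι₁)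
        (HG : Type) (_ : NormedAddCommGroup HG) (_ : InnerProductSpace ℂ HG) (_ : CompleteSpace HG)
        (emb : ∀ Γ : Level V, U.CohC (U.pms F ι₁ V Γ) 2 →ₗ[ℂ] HG)
        (cover : ∀ (Γ Γ' : Level V), Γ' ≤ Γ → U.Mor (U.pms F ι₁ V Γ') (U.pms F ι₁ V Γ))
        (H CG G SK SigIdx SigIdxG : Type)
        (_ : NormedAddCommGroup H) (_ : InnerProductSpace ℂ H) (_ : CompleteSpace H)
        (_ : NormedAddCommGroup CG) (_ : NormedSpace ℂ CG) (_ : Group G) (_ : TopologicalSpace G) (_ : TopologicalSpace SK)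
        (Siso : Perl34.IsolationSetting H HG CG G SK SigIdx SigIdxG),
        S.TranslateClosed Hk ∧
        IsolationSpans.Gen12 U emb S.Theta (IsolationSpans.Datum.ofSetting Siso) ∧
        (∀ χ : Siso.t34.X, Siso.t34.allowed χ → ∀ Φ : SK,
          Siso.t34.ϑ χ Φ ∈ (Submodule.span ℂ (thetaWedgeFns U emb S.Theta 2 3)).topologicalClosure) ∧
        (∀ (Γ Γ' : Level V) (hle : Γ' ≤ Γ) (x : U.CohC (U.pms F ι₁ V Γ) 2),
          emb Γ' (U.pullC (cover Γ Γ' hle) 2 x) = emb Γ x) ∧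
        (∀ Γ : Level V, ∃ c : ℂ, c ≠ 0 ∧ ∀ x y : U.CohC (U.pms F ι₁ V Γ) 2,
          x ∈ (U.hodge (U.pms F ι₁ V Γ) 2).F 2 → y ∈ (U.hodge (U.pms F ι₁ V Γ) 2).F 2 →
            ⟪emb Γ y, emb Γ x⟫_ℂ = c * U.trC (U.pms F ι₁ V Γ) 4 (U.cup2C (U.pms F ι₁ V Γ) 2 x (conj y)))) :
    U.FaceThetaDataExists := by
  intro F hG h6 f
  obtain ⟨ι₁, hι, V, S, HG, _, _, _, emb, cover, H, CG, G, SK, SigIdx, SigIdxG, _, _, _, _, _, _, _, _, Siso,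
    hT, hg, hr, hcov, hinner⟩ := h F hG h6 f
  exact ⟨ι₁, hι, V, nonempty_faceThetaDatum_of_jointThetaPin hH hcup2 hW (fun Γ η hη h0 => hHR Γ η hη h0) S emb cover Siso
    hT hg hr hcov hinner⟩

end Transposition

/-! ## §2  The model universe: facts, Hodge–Riemann (2,0) and B01-H within the honest Hecke family discharged -/

namespace Model

open Transposition

/-- **STRENGTH on the model universe.**  On `U = picardCMUniverse hHD hI h₁ h₃` the facts `Fact_pull_hodge`/`Fact_cup2_hodge`
(`universeOf_fact_pull_hodge`/`_cup2_hodge`), Hodge–Riemann (2,0) on the towers (`universeOf_hodgeRiemann_pms`) and B01-H within the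
honest Hecke family (`Transposition.Model.heckeWedge10Within_holds`) are TREE THEOREMS; so the joint theta-pinned hypothesis per face
implies the free socket form per face, with no other binder.  `HC_CM` is NOT proved: nobody has inhabited `h`. [folklore] -/
theorem exists_faceThetaDatum_free_of_jointThetaPin (hHD : exists_isReal_hodgeModel) (hI : hodgePQ_independent_of_hodgeModel)
    (h₁ : BallQuotientUniformised) (h₃ : CMAbelianVarietyRealised)
    (h : ∀ (F : CMField), IsGalois ℚ F → 6 ≤ Module.finrank ℚ F → ∀ f : Face F,
      ∃ (ι₁ : F →+* ℂ) (V : HermSpace3 F ι₁) (σ : F →+* ℂ)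
        (S : FaceThetaSupply (picardCMUniverse hHD hI h₁ h₃) ι₁ V F f.psi σ)
        (HG : Type) (_ : NormedAddCommGroup HG) (_ : InnerProductSpace ℂ HG) (_ : CompleteSpace HG)
        (emb : ∀ Γ : Level V,
          (picardCMUniverse hHD hI h₁ h₃).CohC ((picardCMUniverse hHD hI h₁ h₃).pms F ι₁ V Γ) 2 →ₗ[ℂ] HG)
        (cover : ∀ (Γ Γ' : Level V), Γ' ≤ Γ →
          (picardCMUniverse hHD hI h₁ h₃).Mor ((picardCMUniverse hHD hI h₁ h₃).pms F ι₁ V Γ')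
            ((picardCMUniverse hHD hI h₁ h₃).pms F ι₁ V Γ))
        (H CG G SK SigIdx SigIdxG : Type)
        (_ : NormedAddCommGroup H) (_ : InnerProductSpace ℂ H) (_ : CompleteSpace H)
        (_ : NormedAddCommGroup CG) (_ : NormedSpace ℂ CG) (_ : Group G) (_ : TopologicalSpace G) (_ : TopologicalSpace SK)
        (Siso : Perl34.IsolationSetting H HG CG G SK SigIdx SigIdxG),
        S.TranslateClosed (Transposition.Model.heckeFamily hHD hI h₁ h₃) ∧
        IsolationSpans.Gen12 (picardCMUniverse hHD hI h₁ h₃) emb S.Theta (IsolationSpans.Datum.ofSetting Siso) ∧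
        (∀ χ : Siso.t34.X, Siso.t34.allowed χ → ∀ Φ : SK,
          Siso.t34.ϑ χ Φ ∈ (Submodule.span ℂ
            (thetaWedgeFns (picardCMUniverse hHD hI h₁ h₃) emb S.Theta 2 3)).topologicalClosure) ∧
        (∀ (Γ Γ' : Level V) (hle : Γ' ≤ Γ) (x : (picardCMUniverse hHD hI h₁ h₃).CohC
            ((picardCMUniverse hHD hI h₁ h₃).pms F ι₁ V Γ) 2),
          emb Γ' ((picardCMUniverse hHD hI h₁ h₃).pullC (cover Γ Γ' hle) 2 x) = emb Γ x) ∧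
        (∀ Γ : Level V, ∃ c : ℂ, c ≠ 0 ∧
          ∀ x y : (picardCMUniverse hHD hI h₁ h₃).CohC ((picardCMUniverse hHD hI h₁ h₃).pms F ι₁ V Γ) 2,
          x ∈ ((picardCMUniverse hHD hI h₁ h₃).hodge ((picardCMUniverse hHD hI h₁ h₃).pms F ι₁ V Γ) 2).F 2 →
          y ∈ ((picardCMUniverse hHD hI h₁ h₃).hodge ((picardCMUniverse hHD hI h₁ h₃).pms F ι₁ V Γ) 2).F 2 →
            ⟪emb Γ y, emb Γ x⟫_ℂ = c * (picardCMUniverse hHD hI h₁ h₃).trC ((picardCMUniverse hHD hI h₁ h₃).pms F ι₁ V Γ) 4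
              ((picardCMUniverse hHD hI h₁ h₃).cup2C ((picardCMUniverse hHD hI h₁ h₃).pms F ι₁ V Γ) 2 x (conj y)))) :
    ∀ (F : CMField), IsGalois ℚ F → 6 ≤ Module.finrank ℚ F → ∀ f : Face F,
      ∃ (ι₁ : F →+* ℂ) (V : HermSpace3 F ι₁) (σ : F →+* ℂ),
        Nonempty ((picardCMUniverse hHD hI h₁ h₃).FaceThetaDatum ι₁ V F f.psi σ) :=
  Transposition.exists_faceThetaDatum_free_of_jointThetaPin
    (universeOf_fact_pull_hodge hHD hI (ballQuotientUniformisedDatum_of h₁) h₃)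
    (universeOf_fact_cup2_hodge hHD hI (ballQuotientUniformisedDatum_of h₁) h₃)
    (Transposition.Model.heckeWedge10Within_holds hHD hI h₁ h₃)
    (fun Γ η hη h0 => universeOf_hodgeRiemann_pms hHD hI (ballQuotientUniformisedDatum_of h₁) h₃ _ Γ η hη h0) h

/-- **The joint theta-pinned end display (O-J) on the model universe.**  Per Galois CM field `F` of degree `≥ 6` and face `f`,
at SOME `(ι₁, V, σ)`: a theta supply datum `S` (theta sets `Θ_i ⊆ U_{ψ_i}`, two non-zero theta classes of slots 0, 1 at one
level), translate-closure of its theta sets along the honest Hecke family, item (iii)'s `L²` dictionary `(HG, emb, cover)` with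
level compatibility and Petersson = cup, an isolation setting `Siso` of the chosen seesaw configuration over the same `HG`, and the
two Lemma-3.5 memberships `Gen12` / `Real34` FOR THE THETA SETS OF `S` — give `HC_CM`.  Composition of `hc_cm_of_items_free` with
`wedge_of_translateClosed_heckeFamily` (Prop 4.3 = supply + B01-H within the family + translate-closure) and
`IsolationSpans.ofSetting` (Lemma 3.5 + Thm 3.7 + Lemma 3.5).  `hR` = Hom-fullness, a tree theorem on the universe of record.
(Statement: own-b01 gen 2, probe 214935dcfd1b; proof routed through `exists_faceThetaDatum_free_of_jointThetaPin`, the engine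
`Universe.exists_periodNV_free_of_exists_faceThetaDatum` and `hc_cm_of_exists_facePeriod_free`, i.e. through the free socket.)
`HC_CM` is NOT proved: every binder of `h` is open at a general face. [folklore] -/
theorem hc_cm_of_jointThetaPin (hHD : exists_isReal_hodgeModel) (hI : hodgePQ_independent_of_hodgeModel)
    (h₁ : BallQuotientUniformised) (h₃ : CMAbelianVarietyRealised) (hR : DeligneMilne1982_Thm_6_20_full)
    (h : ∀ (F : CMField), IsGalois ℚ F → 6 ≤ Module.finrank ℚ F → ∀ f : Face F,
      ∃ (ι₁ : F →+* ℂ) (V : HermSpace3 F ι₁) (σ : F →+* ℂ)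
        (S : FaceThetaSupply (picardCMUniverse hHD hI h₁ h₃) ι₁ V F f.psi σ)
        (HG : Type) (_ : NormedAddCommGroup HG) (_ : InnerProductSpace ℂ HG) (_ : CompleteSpace HG)
        (emb : ∀ Γ : Level V,
          (picardCMUniverse hHD hI h₁ h₃).CohC ((picardCMUniverse hHD hI h₁ h₃).pms F ι₁ V Γ) 2 →ₗ[ℂ] HG)
        (cover : ∀ (Γ Γ' : Level V), Γ' ≤ Γ →
          (picardCMUniverse hHD hI h₁ h₃).Mor ((picardCMUniverse hHD hI h₁ h₃).pms F ι₁ V Γ')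
            ((picardCMUniverse hHD hI h₁ h₃).pms F ι₁ V Γ))
        (H CG G SK SigIdx SigIdxG : Type)
        (_ : NormedAddCommGroup H) (_ : InnerProductSpace ℂ H) (_ : CompleteSpace H)
        (_ : NormedAddCommGroup CG) (_ : NormedSpace ℂ CG) (_ : Group G) (_ : TopologicalSpace G) (_ : TopologicalSpace SK)
        (Siso : Perl34.IsolationSetting H HG CG G SK SigIdx SigIdxG),
        S.TranslateClosed (Transposition.Model.heckeFamily hHD hI h₁ h₃) ∧
        IsolationSpans.Gen12 (picardCMUniverse hHD hI h₁ h₃) emb S.Theta (IsolationSpans.Datum.ofSetting Siso) ∧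
        (∀ χ : Siso.t34.X, Siso.t34.allowed χ → ∀ Φ : SK,
          Siso.t34.ϑ χ Φ ∈ (Submodule.span ℂ
            (thetaWedgeFns (picardCMUniverse hHD hI h₁ h₃) emb S.Theta 2 3)).topologicalClosure) ∧
        (∀ (Γ Γ' : Level V) (hle : Γ' ≤ Γ) (x : (picardCMUniverse hHD hI h₁ h₃).CohC
            ((picardCMUniverse hHD hI h₁ h₃).pms F ι₁ V Γ) 2),
          emb Γ' ((picardCMUniverse hHD hI h₁ h₃).pullC (cover Γ Γ' hle) 2 x) = emb Γ x) ∧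
        (∀ Γ : Level V, ∃ c : ℂ, c ≠ 0 ∧
          ∀ x y : (picardCMUniverse hHD hI h₁ h₃).CohC ((picardCMUniverse hHD hI h₁ h₃).pms F ι₁ V Γ) 2,
          x ∈ ((picardCMUniverse hHD hI h₁ h₃).hodge ((picardCMUniverse hHD hI h₁ h₃).pms F ι₁ V Γ) 2).F 2 →
          y ∈ ((picardCMUniverse hHD hI h₁ h₃).hodge ((picardCMUniverse hHD hI h₁ h₃).pms F ι₁ V Γ) 2).F 2 →
            ⟪emb Γ y, emb Γ x⟫_ℂ = c * (picardCMUniverse hHD hI h₁ h₃).trC ((picardCMUniverse hHD hI h₁ h₃).pms F ι₁ V Γ) 4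
              ((picardCMUniverse hHD hI h₁ h₃).cup2C ((picardCMUniverse hHD hI h₁ h₃).pms F ι₁ V Γ) 2 x (conj y)))) :
    HC_CM :=
  hc_cm_of_exists_facePeriod_free hHD hI h₁ h₃
    (Universe.exists_periodNV_free_of_exists_faceThetaDatum
      (universeOf_fact_pull_comp hHD hI (ballQuotientUniformisedDatum_of h₁) h₃)
      (universeOf_fact_pull_hodge hHD hI (ballQuotientUniformisedDatum_of h₁) h₃)
      (universeOf_fact_cup2_hodge hHD hI (ballQuotientUniformisedDatum_of h₁) h₃)
      (universeOf_fact_pull_cup hHD hI (ballQuotientUniformisedDatum_of h₁) h₃)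
      (exists_faceThetaDatum_free_of_jointThetaPin hHD hI h₁ h₃ h))
    hR

/-- The same on the universe OF RECORD (the four `_holds` data and `deligneMilne1982_Thm_6_20_full_holds` plugged in), stated with
`let U := U_rec` for legibility (own-b01 gen 2, probe 214935dcfd1b).  ONE binder.  Proof: the one-binder socket theorem
`Model.hc_cm_closed_of_exists_faceThetaDatum_free` (`AssemblyFree.lean`) after `exists_faceThetaDatum_free_of_jointThetaPin` — the
display FACTORS through the free socket.  `HC_CM` is NOT proved: nobody has inhabited the hypothesis. [folklore] -/
theorem hc_cm_of_jointThetaPin_rec :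
    let U := picardCMUniverse exists_isReal_hodgeModel_holds hodgePQ_independent_of_hodgeModel_holds
      BallQuotient.ballQuotientUniformised_holds cmAbelianVarietyRealised_holds
    (∀ (F : CMField), IsGalois ℚ F → 6 ≤ Module.finrank ℚ F → ∀ f : Face F,
      ∃ (ι₁ : F →+* ℂ) (V : HermSpace3 F ι₁) (σ : F →+* ℂ)
        (S : FaceThetaSupply U ι₁ V F f.psi σ)
        (HG : Type) (_ : NormedAddCommGroup HG) (_ : InnerProductSpace ℂ HG) (_ : CompleteSpace HG)
        (emb : ∀ Γ : Level V, U.CohC (U.pms F ι₁ V Γ) 2 →ₗ[ℂ] HG)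
        (cover : ∀ (Γ Γ' : Level V), Γ' ≤ Γ → U.Mor (U.pms F ι₁ V Γ') (U.pms F ι₁ V Γ))
        (H CG G SK SigIdx SigIdxG : Type)
        (_ : NormedAddCommGroup H) (_ : InnerProductSpace ℂ H) (_ : CompleteSpace H)
        (_ : NormedAddCommGroup CG) (_ : NormedSpace ℂ CG) (_ : Group G) (_ : TopologicalSpace G) (_ : TopologicalSpace SK)
        (Siso : Perl34.IsolationSetting H HG CG G SK SigIdx SigIdxG),
        S.TranslateClosed (Transposition.Model.heckeFamily exists_isReal_hodgeModel_holds hodgePQ_independent_of_hodgeModel_holds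
          BallQuotient.ballQuotientUniformised_holds cmAbelianVarietyRealised_holds) ∧
        IsolationSpans.Gen12 U emb S.Theta (IsolationSpans.Datum.ofSetting Siso) ∧
        (∀ χ : Siso.t34.X, Siso.t34.allowed χ → ∀ Φ : SK,
          Siso.t34.ϑ χ Φ ∈ (Submodule.span ℂ (thetaWedgeFns U emb S.Theta 2 3)).topologicalClosure) ∧
        (∀ (Γ Γ' : Level V) (hle : Γ' ≤ Γ) (x : U.CohC (U.pms F ι₁ V Γ) 2),
          emb Γ' (U.pullC (cover Γ Γ' hle) 2 x) = emb Γ x) ∧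
        (∀ Γ : Level V, ∃ c : ℂ, c ≠ 0 ∧ ∀ x y : U.CohC (U.pms F ι₁ V Γ) 2,
          x ∈ (U.hodge (U.pms F ι₁ V Γ) 2).F 2 → y ∈ (U.hodge (U.pms F ι₁ V Γ) 2).F 2 →
            ⟪emb Γ y, emb Γ x⟫_ℂ = c * U.trC (U.pms F ι₁ V Γ) 4 (U.cup2C (U.pms F ι₁ V Γ) 2 x (conj y)))) →
    HC_CM :=
  fun h ↦ hc_cm_closed_of_exists_faceThetaDatum_free (exists_faceThetaDatum_free_of_jointThetaPin _ _ _ _ h)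

/-- **Legible form over `hU : U = U_rec` with the Hecke family displayed** (the pattern of `hc_cm_of_supply_of_dictionary_of_eq`,
`Transposition/Item6HoldsRec.lean`:205): for a universe `U` equal to the universe of record (instantiate `hU` with `rfl`), ANY Hecke
family `Hk : Transposition.HeckeFamily U` with B01-H within it (`hW`; for the honest family `Transposition.Model.heckeFamily …` this is
the tree theorem `Transposition.Model.heckeWedge10Within_holds`), and the joint theta-pinned hypothesis `h` with translate-closure
along `Hk` — `HC_CM`.  The facts and Hodge–Riemann (2,0) are discharged after `subst`.  `HC_CM` is NOT proved: `h` is inhabited by no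
one. [folklore] -/
theorem hc_cm_of_jointThetaPin_of_eq (U : Universe)
    (hU : U = picardCMUniverse exists_isReal_hodgeModel_holds hodgePQ_independent_of_hodgeModel_holds
      BallQuotient.ballQuotientUniformised_holds cmAbelianVarietyRealised_holds)
    (Hk : HeckeFamily U) (hW : HeckeWedge10Within U Hk)
    (h : ∀ (F : CMField), IsGalois ℚ F → 6 ≤ Module.finrank ℚ F → ∀ f : Face F,
      ∃ (ι₁ : F →+* ℂ) (V : HermSpace3 F ι₁) (σ : F →+* ℂ)
        (S : FaceThetaSupply U ι₁ V F f.psi σ)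
        (HG : Type) (_ : NormedAddCommGroup HG) (_ : InnerProductSpace ℂ HG) (_ : CompleteSpace HG)
        (emb : ∀ Γ : Level V, U.CohC (U.pms F ι₁ V Γ) 2 →ₗ[ℂ] HG)
        (cover : ∀ (Γ Γ' : Level V), Γ' ≤ Γ → U.Mor (U.pms F ι₁ V Γ') (U.pms F ι₁ V Γ))
        (H CG G SK SigIdx SigIdxG : Type)
        (_ : NormedAddCommGroup H) (_ : InnerProductSpace ℂ H) (_ : CompleteSpace H)
        (_ : NormedAddCommGroup CG) (_ : NormedSpace ℂ CG) (_ : Group G) (_ : TopologicalSpace G) (_ : TopologicalSpace SK)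
        (Siso : Perl34.IsolationSetting H HG CG G SK SigIdx SigIdxG),
        S.TranslateClosed Hk ∧
        IsolationSpans.Gen12 U emb S.Theta (IsolationSpans.Datum.ofSetting Siso) ∧
        (∀ χ : Siso.t34.X, Siso.t34.allowed χ → ∀ Φ : SK,
          Siso.t34.ϑ χ Φ ∈ (Submodule.span ℂ (thetaWedgeFns U emb S.Theta 2 3)).topologicalClosure) ∧
        (∀ (Γ Γ' : Level V) (hle : Γ' ≤ Γ) (x : U.CohC (U.pms F ι₁ V Γ) 2),
          emb Γ' (U.pullC (cover Γ Γ' hle) 2 x) = emb Γ x) ∧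
        (∀ Γ : Level V, ∃ c : ℂ, c ≠ 0 ∧ ∀ x y : U.CohC (U.pms F ι₁ V Γ) 2,
          x ∈ (U.hodge (U.pms F ι₁ V Γ) 2).F 2 → y ∈ (U.hodge (U.pms F ι₁ V Γ) 2).F 2 →
            ⟪emb Γ y, emb Γ x⟫_ℂ = c * U.trC (U.pms F ι₁ V Γ) 4 (U.cup2C (U.pms F ι₁ V Γ) 2 x (conj y)))) :
    HC_CM := by
  subst hU
  exact hc_cm_closed_of_exists_faceThetaDatum_free
    (Transposition.exists_faceThetaDatum_free_of_jointThetaPin (universeOf_fact_pull_hodge _ _ _ _)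
      (universeOf_fact_cup2_hodge _ _ _ _) hW (fun Γ η hη h0 => universeOf_hodgeRiemann_pms _ _ _ _ _ Γ η hη h0) h)

#print axioms hc_cm_of_jointThetaPin
#print axioms hc_cm_of_jointThetaPin_rec
#print axioms hc_cm_of_jointThetaPin_of_eq

end Model

end Summit.HodgeConjecture.CorCM

end
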